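import Mathlib.MeasureTheory.Measure.Prod
import Literature.Analysis.FluidPDE.HardSphereFlowJointMeasurable
import Summits.AtomisticToContinuum.HydrodynamicLimit.Theorems.CollisionIsometryCLTMacroClosureDefs

/-!
# Sub-goal `engine_flowMeasurable` of `stub_engine` (line `IdeatorTwoGen1Sketch`, crux `MacroClosure`,
# stmt-14870): joint a.e.-measurability of the hard-sphere flow

For a hard-sphere flow `Φ` on `𝕋³` and any finite law `μ` carried by the good set (`μ goodᶜ = 0`), the
map `(s, z) ↦ Φ_s z` is a.e.-measurable for `volume.prod μ` on `ℝ × Config`. This is what the engine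
needs to swap `E` and `∫ ds` (Tonelli/Fubini) in pathwise time integrals.

Proof: on `ℝ × Φ.good` the flow is jointly measurable — orbits of good points are right-continuous
hard-sphere trajectories, so `Φ_s z` is the pointwise limit of the dyadic approximants
`Φ_{(⌊2ⁿs⌋+1)/2ⁿ} z`, each measurable (`HardSphereFlow.measurable_flow_prod_torus`, Literature). The
measurable set `ℝ × Φ.good` is `volume.prod μ`-conull (`Measure.prod_prod`, `μ goodᶜ = 0`), so the flow
is a.e.-measurable for the restriction of `volume.prod μ` to it
(`aemeasurable_restrict_of_measurable_subtype`), and that restriction is `volume.prod μ` itself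
(`Measure.restrict_eq_self_of_ae_mem`).
-/

noncomputable section

open MeasureTheory Filter Set Topology InformationTheory
open scoped ENNReal ContDiff

namespace Summit.AtomisticToContinuum.HydrodynamicLimit.Theorems.MacroClosureLine

open Literature.MathematicalPhysics.KineticTheory Literature.Analysis.FluidPDE
open Literature.Analysis.FunctionSpaces

namespace Barycentric

/-- The flow restricted to the measurable cylinder `ℝ × Φ.good` (as a subtype of `ℝ × Config`) is
measurable: composition of `HardSphereFlow.measurable_flow_prod_torus` with the measurable
re-bracketing `⟨(s, z), h⟩ ↦ (⟨z, h⟩, s)`. -/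
theorem measurable_flow_restrict_cylinder {σ : ℝ} {N : ℕ} (Φ : Flow σ N) :
    Measurable fun q : (Prod.snd ⁻¹' Φ.good : Set (ℝ × Config (N + 1) (Fin 3) T3)) =>
      Φ.flow (q : ℝ × Config (N + 1) (Fin 3) T3).1 (q : ℝ × Config (N + 1) (Fin 3) T3).2 := by
  have hre : Measurable fun q : (Prod.snd ⁻¹' Φ.good : Set (ℝ × Config (N + 1) (Fin 3) T3)) =>
      ((⟨(q : ℝ × Config (N + 1) (Fin 3) T3).2, q.2⟩ : Φ.good),
        (q : ℝ × Config (N + 1) (Fin 3) T3).1) :=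
    ((measurable_snd.comp measurable_subtype_coe).subtype_mk).prodMk
      (measurable_fst.comp measurable_subtype_coe)
  exact Φ.measurable_flow_prod_torus.comp hre

/-- S8 JOINT MEASURABILITY: the flow is jointly (a.e.-)measurable in `(s, z)` for any law charging only good
configurations (right-continuity of hard-sphere trajectories). -/
theorem engine_flowMeasurable : ∀ (σ : ℝ) (N : ℕ) (Φ : Flow σ N)
    (μ : Measure (Config (N + 1) (Fin 3) T3)) [IsFiniteMeasure μ], μ (Φ.good)ᶜ = 0 →
    AEMeasurable (fun p : ℝ × Config (N + 1) (Fin 3) T3 => Φ.flow p.1 p.2)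
      ((volume : Measure ℝ).prod μ) := by
  intro σ N Φ μ _ hμ
  set s : Set (ℝ × Config (N + 1) (Fin 3) T3) := Prod.snd ⁻¹' Φ.good with hs
  have hsm : MeasurableSet s := measurable_snd Φ.measurableSet_good
  -- the cylinder `ℝ × good` is conull for `volume.prod μ`
  have hnull : ((volume : Measure ℝ).prod μ) sᶜ = 0 := by
    have hcyl : sᶜ = (univ : Set ℝ) ×ˢ (Φ.good)ᶜ := by
      ext p
      simp [hs]
    rw [hcyl, Measure.prod_prod, hμ, mul_zero]
  have hae : ∀ᵐ p ∂((volume : Measure ℝ).prod μ), p ∈ s := by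
    rw [ae_iff]
    simpa only [← compl_setOf, setOf_mem_eq] using hnull
  -- a.e.-measurable for the restriction to the cylinder, which is the whole measure
  have h1 : AEMeasurable (fun p : ℝ × Config (N + 1) (Fin 3) T3 => Φ.flow p.1 p.2)
      (((volume : Measure ℝ).prod μ).restrict s) :=
    aemeasurable_restrict_of_measurable_subtype hsm (measurable_flow_restrict_cylinder Φ)
  rwa [Measure.restrict_eq_self_of_ae_mem hae] at h1

end Barycentric

end Summit.AtomisticToContinuum.HydrodynamicLimit.Theorems.MacroClosureLine

end
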